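import Mathlib
import HarnessLib
import HarnessLib.Audit
import Summits.SmoothPoincare4.Statement
import Literature.Topology.FourManifolds.ConnectedSum
import Literature.Topology.FourManifolds.ComplexProjectiveSpace
import Literature.Topology.FourManifolds.HomotopyS4OrientableProofs
import HarnessLib.Audit.Status.Attr

/-!
Route: RootDecompB

# Route RootDecompB — Root decomposition B (DefiniteCarving, lens 6) — every homotopy 4-sphere
dissolves in a one-chirality sum of projective planes, plus definite cancellation (declared
residual)

ROOT DECOMPOSITION NODE B of cell decomp-sp4 (D-0178, LADDER-SmoothPoincare4 rung 0; lens 6 =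
barrier-complement carving; node DefiniteCarving, adopted by the route-writer as OR-sibling
RootDecompB). TARGET = the ROOT `_root_.SmoothPoincare4` verbatim ⟸ DefiniteDissolution ∧
DefiniteCancellation. It suffices to show X = DefiniteDissolution ∧ DefiniteCancellation, and X is
EXACTLY the summit (kernel `smoothPoincare4_iff_definiteCarving` in the
decomp-sp4 node file): (E) every smooth homotopy 4-sphere M dissolves in SOME one-chirality sum of
projective planes — there is n and a coherently
oriented blow-up chain P 0 ≅ M, P (i+1) = P i # ℂℙ² (same oriented ℂℙ² at every step) and a chain Q
0 ≅ S⁴, Q (i+1) = Q i # ℂℙ² with P n ≅ Q n,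
informally M # nℂℙ² ≅ #nℂℙ² or M # nℂℙ²bar ≅ #nℂℙ²bar («definite Wall theorem», MMSW 2023 Question
9.12 for all homotopy spheres); (R) such a
one-chirality dissolution cancels: P n ≅ Q n ⟹ M ≅ S⁴. Root decomposition node of cell decomp-sp4
(lens 6, barrier-complement carving); no card. SmoothPoincare4 is NOT proved by anything here: both
pieces are open and S-implied, the conjunction gives S by `closes`, and DefiniteCancellation is
DECLARED RESIDUAL (critic ruling: scored on E only; no seat on R until a ℂℙ²-cancellation mechanism
is named).
Lean: `(open scoped ContDiff in ∀ (M : Type) [TopologicalSpace M] [T2Space M]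
[SecondCountableTopology M] [ChartedSpace (EuclideanSpace ℝ (Fin 4)) M] [IsManifold (𝓡 4) ∞ M],
Nonempty (ContinuousMap.HomotopyEquiv M (Metric.sphere (0 : EuclideanSpace ℝ (Fin 5)) 1)) → ∃ (n :
ℕ) (P Q : ℕ → Type) (_ : ∀ i, TopologicalSpace (P i)) (_ : ∀ i, T2Space (P i)) (_ : ∀ i,
SecondCountableTopology (P i)) (_ : ∀ i, ChartedSpace (EuclideanSpace ℝ (Fin 4)) (P i)) (_ : ∀ i,
IsManifold (𝓡 4) ∞ (P i)) (_ : ∀ i, CompactSpace (P i)) (_ : ∀ i, TopologicalSpace (Q i)) (_ : ∀ i,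
T2Space (Q i)) (_ : ∀ i, SecondCountableTopology (Q i)) (_ : ∀ i, ChartedSpace (EuclideanSpace ℝ
(Fin 4)) (Q i)) (_ : ∀ i, IsManifold (𝓡 4) ∞ (Q i)) (_ : ∀ i, CompactSpace (Q i)) (o : ∀ i,
Literature.Topology.FourManifolds.SmoothOrientation (𝓡 4) (P i)) (c : ∀ i, i < n →
Literature.Topology.FourManifolds.SmoothOrientation (𝓡 4)
Literature.Topology.FourManifolds.ComplexProjectivePlane), Nonempty (P 0 ≃ₘ⟮𝓡 4, 𝓡 4⟯ M) ∧ Nonempty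
(Q 0 ≃ₘ⟮𝓡 4, 𝓡 4⟯ (Metric.sphere (0 : EuclideanSpace ℝ (Fin 5)) 1)) ∧ (∀ i (hi : i < n),
Literature.Topology.FourManifolds.IsOrientedConnectedSum (o i) (c i hi) (o (i + 1))) ∧ (∀ i j (hi :
i < n) (hj : j < n), c i hi = c j hj) ∧ (∀ i < n, Literature.Topology.FourManifolds.IsConnectedSum
(𝓡 4) (𝓡 4) (𝓡 4) (Q i) Literature.Topology.FourManifolds.ComplexProjectivePlane (Q (i + 1))) ∧
Nonempty (P n ≃ₘ⟮𝓡 4, 𝓡 4⟯ Q n)) ∧ (open scoped ContDiff in ∀ (M : Type) [TopologicalSpace M]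
[T2Space M] [SecondCountableTopology M] [ChartedSpace (EuclideanSpace ℝ (Fin 4)) M] [IsManifold (𝓡
4) ∞ M], Nonempty (ContinuousMap.HomotopyEquiv M (Metric.sphere (0 : EuclideanSpace ℝ (Fin 5)) 1)) →
∀ (n : ℕ) (P Q : ℕ → Type) [∀ i, TopologicalSpace (P i)] [∀ i, T2Space (P i)] [∀ i,
SecondCountableTopology (P i)] [∀ i, ChartedSpace (EuclideanSpace ℝ (Fin 4)) (P i)] [∀ i, IsManifold
(𝓡 4) ∞ (P i)] [∀ i, CompactSpace (P i)] [∀ i, TopologicalSpace (Q i)] [∀ i, T2Space (Q i)] [∀ i,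
SecondCountableTopology (Q i)] [∀ i, ChartedSpace (EuclideanSpace ℝ (Fin 4)) (Q i)] [∀ i, IsManifold
(𝓡 4) ∞ (Q i)] [∀ i, CompactSpace (Q i)] (o : ∀ i,
Literature.Topology.FourManifolds.SmoothOrientation (𝓡 4) (P i)) (c : ∀ i, i < n →
Literature.Topology.FourManifolds.SmoothOrientation (𝓡 4)
Literature.Topology.FourManifolds.ComplexProjectivePlane), Nonempty (P 0 ≃ₘ⟮𝓡 4, 𝓡 4⟯ M) → Nonempty
(Q 0 ≃ₘ⟮𝓡 4, 𝓡 4⟯ (Metric.sphere (0 : EuclideanSpace ℝ (Fin 5)) 1)) → (∀ i (hi : i < n),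
Literature.Topology.FourManifolds.IsOrientedConnectedSum (o i) (c i hi) (o (i + 1))) → (∀ i j (hi :
i < n) (hj : j < n), c i hi = c j hj) → (∀ i < n, Literature.Topology.FourManifolds.IsConnectedSum
(𝓡 4) (𝓡 4) (𝓡 4) (Q i) Literature.Topology.FourManifolds.ComplexProjectivePlane (Q (i + 1))) →
Nonempty (P n ≃ₘ⟮𝓡 4, 𝓡 4⟯ Q n) → Nonempty (M ≃ₘ⟮𝓡 4, 𝓡 4⟯ (Metric.sphere (0 : EuclideanSpace ℝ (Fin
5)) 1)))`

## Assembly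
Pure logic: unpack the dissolution witness (n, P, Q, orientations, diffeomorphisms) given by
DefiniteDissolution at M and feed it to
DefiniteCancellation at M; `closes` in glue.lean. Both cruxes are S-implied (kernel
`definiteDissolution_of_spc4` with n = 0, `definiteCancellation_of_spc4`).

Rationale: WHY THIS LINE. The dissolution axis of the SPC4 ladder has so far been cut at a FIXED rank
(DissolveOne n = 1 in DissolvableGluck; n ≤ 4 via self-dual metrics in
TwistorDissolution; one S²×S² in Stabilisation), which puts an open closed-case one-stabilisation
problem (Kang arXiv:2210.07510 Question 2) inside the
existence half. Cutting at «∃ n» instead moves all the blow-up room into the existence half E, which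
is then verified on every Gluck twist (Gordon 1976 /
Melvin, tree `dissolvesInCP2_of_isGluckTwist'`) and on Gompf's H_{n,k} family (Gompf 1991 p.102,
−ℂℙ² blow-up collapses without 3-handles) by arguments
not deciding Σ ≅ S⁴, and is MMSW arXiv:1910.08195 Question 9.12 in print. The price is the chirality
clause: orientation-free unbounded dissolution is a
theorem (Θ₄ = 0 + Wall + (S²×S²) # ℂℙ² ≅ 2ℂℙ² # ℂℙ²bar), so the chain must be coherently ORIENTED —
P n is then DEFINITE, and the recognition half R is graded
through the definite family ±nℂℙ², the one b₂-graded population with no known exotic pair at any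
rank (A11-narrow audit, escape (b), owned by no route).
Imported area: Kirby calculus of blow-ups (4-dim handlebody theory); no gauge theory, no invariants.
Workshop record (writer decomp-sp4-writer-1-g0, cell decomp-sp4, rung 0, D-0178): this is root node
DefiniteCarving of lens 6 (NODE 2026-08-30T01:31:02Z on HOME/STATUS.md line 19; lens draft file
decomp-sp4-lens-6/DefiniteCarving.lean sha256
ead3e5eec948481349420fc6d087f45e3e978e937203ef073c7a5503dd40e354, which also proves
definiteDissolution_of_spc4 (n = 0) and definiteCancellation_of_spc4 (NECESSITY: S ⟹ every piece)
and smoothPoincare4_iff_definiteCarving (exactness of the AND, not an EQUIV layer); NODE.md sha256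
8d8c2137702df7fa4e98b814fd263a115470b716e189c059dca74d8f86f5d50e; writer re-check lean rc 0 / 0
sorry / axioms(closes) = propext, Classical.choice, Quot.sound), adopted as OR-sibling RootDecompB
of the root decomposition (sibling of route-SmoothPoincare4-RootDecompA = lens-2 MirrorDichotomy;
the two ANDs are independent: closed definite b₂ > 0 world vs 5-dimensional doubles). Critic
verdict: CLEARED decomp-sp4-crit-1-g0 2026-08-30T01:33:40Z (HOME/STATUS.md line 20 «CLEARED … NODE
lens-6 DefiniteCarving (S ⟸ DefiniteDissolution[E] ∧ DefiniteCancellation[R]; file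
decomp-sp4-lens-6/DefiniteCarving.lean sha256 ead3e5ee…)»; CRITIC-LEDGER.md row lens-6
DefiniteCarving): typing read symbol by symbol (the coherence clause ∀ i j, c i = c j pins ONE
chirality, so P n is DEFINITE; without it E is a theorem by Θ₄ = 0 + Wall and R ≡ S — the clause
removes exactly that slack) ✓, DISTRIBUTED ✓, no EQUIV layer ✓, R2/R6/R7 ✓ (not a rename of
DissolvableGluck n = 1 / TwistorDissolution n ≤ 4 / Stabilisation S²×S²); tags DefiniteDissolution =
WEAKER (census row B3(b) ✓ALL Φ2: every Gluck twist dissolves at n = 1 in both signs, Gordon 1976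
Thm 4.6 / Melvin, tree `dissolvesInCP2_of_isGluckTwist'`; Gompf 1991 p.102 H_(n,k) # −ℂℙ² slides;
dominated by the registered piece DissolveOne stmt-SmoothPoincare4-17710 and by rigidity of any
single #nℂℙ²; printed OPEN: MMSW arXiv:1910.08195 Question 9.12, Kang arXiv:2210.07510 Question 2) ·
ATTACKABLE (Kirby calculus of blow-ups/slides) · INSTRUMENTABLE; DefiniteCancellation = UNDECIDED
(population piece S|definite-dissolvable ⊇ Gluck twist conjecture B4 at n = 1; S-shielded; strict
weakness structurally uncertifiable) ⇒ labelled DECLARED-RESIDUAL for scoring (node score = E; leaf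
IDEA-NEEDED; no seat on R until a ℂℙ²-cancellation mechanism is named); census test named #2:
M10-ℂℙ² (kirby-certificate search for Σ # kℂℙ²bar ≅ #kℂℙ²bar, one sign, k ≤ 3, on the Φ4 T ≤ 18
residue, Φ3 R-links > 14 crossings, Φ5 open rows incl. 18nh_00000601's ball W, Φ6 bounded cork
twists; ≈30 core-h; every certificate is a ✓ in a '?' cell of row B3(b)/E, and a both-sign
certificate also kills the FGMW s-strategy for that Σ via `mmsw2023_sZero_of_dissolvesInCP2`);
non-blocking W1 (kernel domination lemma (body of DissolveOne #17710) → DefiniteDissolution — needs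
the unoriented→oriented connected-sum lemma since #17710 is typed unoriented; left to a prover/lens
as a Theorems file over this route), W2 (foreseen layer-2 split DefiniteCancellation ⟸
DefDescent(n+1 → n, n ≥ 1) ∧ CP2CancellationOne′ shared with DissolvableGluck, to be filed by `route
edit --split` at birth+1 so R's n = 1 layer reuses existing items), W3 (tag chores — done by the
gate). Census instrument cited: HOME/census/COSTUME-CENSUS-v1.md sha256
2113a3b3fb46bf7e878c545d4df5cf6f6d17f195411b0a604bea94d1c5e2365a (COSTUME-CENSUS-v1.json sha256
4ecf75d8f1243bec80a6cd253a099e5495e481c469a741cd69a87d0230d84e02; rows B3(b), T16, T62, I27 read by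
the lens). BC5 witness of weakness: the lever (one-chirality blow-up dissolution) is DECIDED on the
whole Gluck-twist family Φ2 at n = 1 by the tree theorem
`Literature.Topology.FourManifolds.dissolvesInCP2_of_isGluckTwist'` (Gordon/Melvin) — a regime where
S (Gluck twists standard) is NOT known, so the rung lies outside S's proved regime. Why this is
novel (one sentence): it is the first cut of the dissolution axis at UNBOUNDED rank with an explicit
one-chirality clause, which is exactly what keeps the existence half open-but-attackable and the
recognition half graded through the definite family ±nℂℙ² where no exotic pair is known.

RANKED CRUXES. #2 DefiniteCancellation (crux) — for every smooth homotopy 4-sphere M, every n, every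
coherently oriented one-chirality blow-up chain P 0 ≅ M … P n and every chain Q 0 ≅ S⁴ … Q n of
ℂℙ²-sums: P n ≅ Q n → M ≅ S⁴ (M # nℂℙ² ≅ #nℂℙ² ⟹ M ≅ S⁴); n = 1 layer ⟺ DIG ∧ GLUCK
(DissolvableGluck SplitExact). DECLARED RESIDUAL of this node (no seat asked). Critic verdict:
UNDECIDED (population piece S|definite-dissolvable ⊇ Gluck twist conjecture at n = 1; S-shielded;
strict weakness structurally uncertifiable; only S-independent access R|1 ⟸ Kirby 4.23) ⇒
DECLARED-RESIDUAL for scoring · leaf IDEA-NEEDED — CLEARED decomp-sp4-crit-1-g0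
2026-08-30T01:33:40Z. [difficulty: open-problem] (why it might fail: an exotic S⁴ that dissolves
after blow-ups of one sign refutes it (SPC4-shielded); no cancellation mechanism for ℂℙ² summands
exists — light-bulb theorems need a square-0 dual, the lattice ⟨1⟩ⁿ has none; contains the Gluck
twist conjecture at n = 1.) [arXiv:1910.08195, arXiv:2210.07510, Kirby1997]
#3 DefiniteDissolution (crux) — every smooth homotopy 4-sphere M admits, for some n ≥ 0, a
coherently oriented one-chirality blow-up chain P 0 ≅ M, P (i+1) = P i # ℂℙ² and a chain Q 0 ≅ S⁴, Q
(i+1) = Q i # ℂℙ² with P n ≅ Q n (M # nℂℙ² ≅ #nℂℙ² or M # nℂℙ²bar ≅ #nℂℙ²bar for some n). Critic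
verdict: WEAKER (census B3(b) ✓ALL Φ2 — Gordon 1976 Thm 4.6 / Melvin, tree
`dissolvesInCP2_of_isGluckTwist'`; Gompf 1991 p.102; dominated by DissolveOne
stmt-SmoothPoincare4-17710 and by rigidity of any single #nℂℙ²; printed OPEN arXiv:1910.08195 Q9.12,
arXiv:2210.07510 Q2) · ATTACKABLE (Kirby calculus) · INSTRUMENTABLE (test M10-ℂℙ², ≈30 core-h) —
CLEARED decomp-sp4-crit-1-g0 2026-08-30T01:33:40Z; node score = this piece. [difficulty: L] (why it
might fail: a homotopy sphere built to defeat the FGMW s-strategy's converse could resist one-sign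
blow-ups at every rank; only Gluck twists (n = 1) and Gompf's H_(n,k) family are verified; MMSW
Q9.12 is open even for presentation spheres D(P).) [arXiv:1910.08195,
doi:10.1016/0040-9383(91)90036-4, arXiv:2210.07510]

TWO-LAYER PLAN. DefiniteCancellation ⇐ DefDescent (M # (n+1)ℂℙ² ≅ #(n+1)ℂℙ² → M # nℂℙ² ≅ #nℂℙ², n ≥
1, one chirality) → CP2CancellationOne' (n = 1, shared with
DissolvableGluck #17710's partner) → DefiniteCancellation; DefiniteDissolution ⇐ per-family
dissolution certificates (presentation spheres, R-link spheres)
are support lemmas, not items.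

KILL CRITERIA. A refutation of DefiniteCancellation is an exotic S⁴ (closes the summit negatively,
route refuted:DefiniteCancellation). A refutation of
DefiniteDissolution exhibits a homotopy sphere resisting all one-sign blow-ups — also exotic; a
proof of DefiniteDissolution alone retires the FGMW
s-strategy for every Σ dissolving with both signs and leaves R as the summit. DissolveOne (#17710)
proved ⟹ E moot (proved), route continues on R.

NOT DECOMPOSED YET. The descent step DefDescent and the n = 1 identification with DIG ∧ GLUCK are
layer-2 (after a crux moves); no per-family items; no metric/gauge sub-claims.

CHEAPEST FALSIFIER. Kirby-calculus run «M10-ℂℙ²» (census menu M10 with k blow-ups of one sign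
instead of S²×S², ≈30 core-h): search slide certificates Σ # kℂℙ²bar ≅ #kℂℙ²bar,
k ≤ 3, on residual presentation spheres (T ≤ 18), R-links of 15–16 crossings, the MP rows 16n68278 /
18nh_00000601 and bounded cork twists; not run (kit not
allowed in this seat). A both-sign certificate for a Σ with a knot K slice in Σ° and s(K) ≠ 0 would
be a contradiction in print-level facts (MMSW) — the
cheapest consistency check of E against the s-programme.

NUMBERS. n = 1: all Gluck twists (both signs); Gompf 1991: H_(n,k) # −ℂℙ² ≅ B⁴ # −ℂℙ² by slides;
definite exotic closed simply connected pairs known: none at any b₂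
(Stipsicz–Szabó 2024 §1); smallest odd indefinite exotic pair: b₂ = 3 (Akhmedov–Park 2010, ℂℙ² #
2ℂℙ²bar).

DEFINITION REQUESTS. None: IsOrientedConnectedSum, SmoothOrientation, ComplexProjectivePlane,
exists_isOrientedConnectedSum_holds are tree declarations.

Novelty: Searches (2026-08-30): lit search --hybrid "homotopy 4-sphere connected sum CP2 diffeomorphic blow
up dissolve" (held: MMSW 1910.08195 p.30, Gompf 1991, Kang 2210.07510); lit galaxy search
"dissolve|blow-up|Gluck twist" --star all (0 relevant new); lean search 'DissolvesInCP2' /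
'IsOrientedConnectedSum' (tree: DissolvableGluck n = 1, TwistorDissolution n ≤ 4,
GluckTwistsDissolve barrier files); ledger negatives SmoothPoincare4 = 0; census COSTUME-CENSUS-v1
rows B3(b), T16, T62, I27.
Nearest prior art found: arXiv:1910.08195 Question 9.12 (dissolution of D(P) in #ʳℂℙ² and #ʳℂℙ²bar
for some r, asked for the s-strategy); route-SmoothPoincare4-DissolvableGluck (DissolveOne, n = 1);
route-SmoothPoincare4-TwistorDissolution (n ≤ 4, self-dual metrics); arXiv:2210.07510 (one
stabilisation not enough for contractible manifolds).
Delta: first statement of the dissolution conjunct at UNBOUNDED rank with an explicit one-chirality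
(definite-type) clause — simultaneously below SPC4, below DissolveOne and below smooth rigidity of
every #nℂℙ² — paired with the matching graded cancellation principle; the coherence clause is what
separates it from Wall's theorem.
Claimed grade: new-combination  [refs: 1910.08195, 2210.07510]

Barriers (technique_class: kirby-calculus, blow-up-dissolution, definite-forms): - technique_class: kirby-calculus, blow-up-dissolution, definite-forms
- Literature.Barriers.SmoothPoincare4.GluckTwistCP2Barrier (GluckTwistsDissolve.lean:
ℂℙ²-cancellative invariants are blind on Gluck twists because Σ_K # ℂℙ² ≅ ℂℙ² and Σ_K # ℂℙ²bar ≅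
ℂℙ²bar, KPR 2023 Lemma 3.1 / MMSW Cor 1.13): it does not evade it and does not need to — the barrier
kills REFUTATIONS of the Gluck twist conjecture by ℂℙ²-stable invariants, while this route refutes
nothing and uses no invariant; the dissolution fact the barrier rests on is precisely the n = 1
evidence FOR DefiniteDissolution (census B3(b)), and the bet is declared: DefiniteCancellation at n
= 1 contains the Gluck twist conjecture (scope caveat (a): for non-Gluck homotopy spheres even ∃ r
dissolution is open, MMSW Q9.12 — that open question IS DefiniteDissolution).
- Literature.Barriers.SmoothPoincare4.OneStabilisationBarrier (OneStabilisationContractible.lean,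
Kang arXiv:2210.07510 Cor 1.2: one S²×S² stabilisation does not suffice for compact contractible
manifolds rel boundary): OUTSIDE by scope — closed homotopy spheres only (scope caveat (a): nothing
about homotopy balls/spheres), the number n of summands is FREE (the route never asserts a uniform
one-stabilisation lemma), and the summand is ℂℙ² of one chirality, not S²×S²; the closed
one-stabilisation case is Kang's Question 1/2, open.
- Literature.Barriers.SmoothPoincare4.HCobordismBarrierFour (BARRIERS.lean §A5, Donaldson: the
smooth h-cobordism principle fails in dim

sub-problem: SmoothPoincare4 · status: draft · opened planner-decomp-sp4-writer-1-g0-0 2026-08-30T02:03:13Z · rev 1 · ledger route-SmoothPoincare4-RootDecompB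
GENERATED by the gate from the ledger (D-0016/17). Provers cite these decls: `theorem foo : Summit.SmoothPoincare4.SmoothPoincare4.Theses.RootDecompB.<Decl> := …` in Summits/SmoothPoincare4/SmoothPoincare4/Theorems/<Name>.lean.
-/

namespace Summit.SmoothPoincare4.SmoothPoincare4.Theses.RootDecompB

open scoped BigOperators Topology Manifold Classical MeasureTheory ProbabilityTheory Matrix InnerProductSpace ComplexConjugate ContinuousMap
open Filter Set Function TopologicalSpace MeasureTheory

attribute [summit_statement] _root_.SmoothPoincare4

open Literature.SPC4

/-- item stmt-SmoothPoincare4-24778 · crux · rank 2 · SPLIT (gen 1) into CP2CancellationOne, DefiniteDescent + glue DefiniteCancellationGlue · direct attempts still welcome (low priority) · by planner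
why it might fail: an exotic S⁴ that dissolves after blow-ups of one sign refutes it (SPC4-shielded); no cancellation mechanism for ℂℙ² summands exists — light-bulb theorems need a square-0 dual, the lattice ⟨1⟩ⁿ has none; contains the Gluck twist conjecture at n = 1.
sources: arXiv:1910.08195, arXiv:2210.07510, Kirby1997
[crux] for every smooth homotopy 4-sphere M, every n, every coherently oriented one-chirality
blow-up chain P 0 ≅ M … P n and every chain Q 0 ≅ S⁴ … Q n of ℂℙ²-sums: P n ≅ Q n → M ≅ S⁴ (M # nℂℙ²
≅ #nℂℙ² ⟹ M ≅ S⁴); n = 1 layer ⟺ DIG ∧ GLUCK (DissolvableGluck SplitExact). DECLARED RESIDUAL of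
this node (no seat asked). Critic verdict: UNDECIDED (population piece S|definite-dissolvable ⊇
Gluck twist conjecture at n = 1; S-shielded; strict weakness structurally uncertifiable; only
S-independent access R|1 ⟸ Kirby 4.23) ⇒ DECLARED-RESIDUAL for scoring · leaf IDEA-NEEDED — CLEARED
decomp-sp4-crit-1-g0 2026-08-30T01:33:40Z. [difficulty: open-problem] -/
@[route_item "route-SmoothPoincare4-RootDecompB", crux]
def DefiniteCancellation : Prop :=
  open scoped ContDiff in ∀ (M : Type) [TopologicalSpace M] [T2Space M] [SecondCountableTopology M] [ChartedSpace (EuclideanSpace ℝ (Fin 4)) M] [IsManifold (𝓡 4) ∞ M], Nonempty (ContinuousMap.HomotopyEquiv M (Metric.sphere (0 : EuclideanSpace ℝ (Fin 5)) 1)) → ∀ (n : ℕ) (P Q : ℕ → Type) [∀ i, TopologicalSpace (P i)] [∀ i, T2Space (P i)] [∀ i, SecondCountableTopology (P i)] [∀ i, ChartedSpace (EuclideanSpace ℝ (Fin 4)) (P i)] [∀ i, IsManifold (𝓡 4) ∞ (P i)] [∀ i, CompactSpace (P i)] [∀ i, TopologicalSpace (Q i)] [∀ i, T2Space (Q i)]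 [∀ i, SecondCountableTopology (Q i)] [∀ i, ChartedSpace (EuclideanSpace ℝ (Fin 4)) (Q i)] [∀ i, IsManifold (𝓡 4) ∞ (Q i)] [∀ i, CompactSpace (Q i)] (o : ∀ i, Literature.Topology.FourManifolds.SmoothOrientation (𝓡 4) (P i)) (c : ∀ i, i < n → Literature.Topology.FourManifolds.SmoothOrientation (𝓡 4) Literature.Topology.FourManifolds.ComplexProjectivePlane), Nonempty (P 0 ≃ₘ⟮𝓡 4, 𝓡 4⟯ M) → Nonempty (Q 0 ≃ₘ⟮𝓡 4, 𝓡 4⟯ (Metric.sphere (0 : EuclideanSpace ℝ (Fin 5)) 1)) → (∀ i (hi : i < n), Literature.Topology.FourManifolds.IsOrientedConnectedSum (o i) (c i hi) (o (i + 1))) → (∀ i j (hi : i < n) (hj : j < n), c i hi = c j hj) → (∀ i < n, Literature.Topology.FourManifolds.IsConnectedSum (𝓡 4) (𝓡 4) (𝓡 4) (Q i) Literature.Topology.FourManifolds.ComplexProjectivePlane (Q (i + 1))) → Nonempty (P n ≃ₘ⟮𝓡 4, 𝓡 4⟯ Q n) → Nonempty (M ≃ₘ⟮𝓡 4, 𝓡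 4⟯ (Metric.sphere (0 : EuclideanSpace ℝ (Fin 5)) 1))

-- parent: DefiniteCancellation · child (gen 1)
/--     item stmt-SmoothPoincare4-17708 · crux · rank 201 · open
    parent: DefiniteCancellation · by planner
    why it might fail: X₁ = DIG ∧ GLUCK: the (+1)-sphere of a rank-one dissolution need not be standard (Melvin blow-down ⇒ only 'Gluck twist on some 2-knot' if it is), and Gluck twists need not be standard (Kirby Problems 4.24/4.45 open; GNS 2023 Q5.6) — either failure kills X₁.
    sources: GompfStipsicz1999 Ex. 5.2.7(b), Gompf1991 doi:10.1016/0040-9383(91)90036-4 p.102, Akbulut2010 arXiv:0907.0136, Kirby1997 Problems 4.24/4.45, arXiv:2307.06388 (GNS) Q5.6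
[target] X₁ — every smooth homotopy 4-sphere M admitting a connected sum P of M with ℂℙ² that is
diffeomorphic to ℂℙ² is diffeomorphic to S⁴ (TwistorDissolution's CP2Cancellation at n = 1, one sum
instead of a chain; the tree's IsConnectedSum is orientation-free, so both M # ℂℙ² and M # ℂℙ²bar
readings are included). -/
@[route_item "route-SmoothPoincare4-RootDecompB"]
def CP2CancellationOne : Prop :=
  open scoped ContDiff in ∀ (M : Type) [TopologicalSpace M] [T2Space M] [SecondCountableTopology M] [ChartedSpace (EuclideanSpace ℝ (Fin 4)) M] [IsManifold (𝓡 4) ∞ M], ContinuousMap.HomotopyEquiv M (Metric.sphere (0 : EuclideanSpace ℝ (Fin 5)) 1) → (∃ (P : Type) (_ : TopologicalSpace P) (_ : T2Space P) (_ : SecondCountableTopology P) (_ : ChartedSpace (EuclideanSpace ℝ (Fin 4)) P) (_ : IsManifold (𝓡 4) ∞ P), Literature.Topology.FourManifolds.IsConnectedSum (𝓡 4) (𝓡 4) (𝓡 4) M Literature.Topology.FourManifolds.ComplexProjectivePlane P ∧ Nonempty (P ≃ₘ⟮𝓡 4, 𝓡 4⟯ Literature.Topology.FourManifolds.ComplexProjectivePlane))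 → Nonempty (M ≃ₘ⟮𝓡 4, 𝓡 4⟯ Metric.sphere (0 : EuclideanSpace ℝ (Fin 5)) 1)

-- parent: DefiniteCancellation · child (gen 1)
/--     item stmt-SmoothPoincare4-26487 · crux · rank 202 · open
    parent: DefiniteCancellation · by planner
    why it might fail: a homotopy sphere might dissolve only at rank ≥ 2: 'one stabilisation is not enough' phenomena exist for S²×S² (Kang arXiv:2210.07510; Hayden–Kang–Mukherjee arXiv:2304.01504; Guth arXiv:2207.11847) and no ℂℙ²-peeling mechanism is known ((+1)-spheres in #nℂℙ² are unclassified).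
    sources: arXiv:2210.07510, arXiv:2304.01504, arXiv:2207.11847, Auckly2003 doi:10.1016/s0166-8641(02)00063-9, Gompf1991 doi:10.1016/0040-9383(91)90036-4, HankeKotschickWehrheim2003 doi:10.1007/s00209-003-0553-8
[critic decomp-sp4-crit-1 g2, CLEARED 2026-08-30T03:05:44Z (HOME/STATUS.md line 100): NEW · WEAKER
(P3 GENUINE: decided TRUE on the Gluck family Φ2, `Split.definiteDescent_on_gluckTwists`, where R|Φ2
⊇ Gluck conjecture is open) · UNDECIDED (no rank-≥2-only specimen known; test M10-ℂℙ² rank profile)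
· IDEA-NEEDED (no ℂℙ²-peeling) · DECLARED RESIDUAL of the split (tribunal_fit residual after edit =
[DefiniteDescent])] DEFINITE DESCENT / RANK COLLAPSE (NEW): if a smooth homotopy 4-sphere M
dissolves in a ONE-CHIRALITY chain of n ≥ 1 projective planes (M # nℂℙ² ≅ #nℂℙ², the data of
DefiniteCancellation: coherently oriented chain P, comparison chain Q from S⁴, P n ≅ Q n) then it
already dissolves after ONE: some connected sum of M with ℂℙ² is diffeomorphic to ℂℙ² (the
hypothesis of X₁/DIG, orientation-free). Typed as DefiniteCancellation with the conclusion `Nonempty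
(M ≃ₘ S⁴)` replaced by `0 < n → ∃ P', IsConnectedSum M ℂℙ² P' ∧ Nonempty (P' ≃ₘ ℂℙ²)`. -/
@[route_item "route-SmoothPoincare4-RootDecompB"]
def DefiniteDescent : Prop :=
  open scoped ContDiff in ∀ (M : Type) [TopologicalSpace M] [T2Space M] [SecondCountableTopology M] [ChartedSpace (EuclideanSpace ℝ (Fin 4)) M] [IsManifold (𝓡 4) ∞ M], Nonempty (ContinuousMap.HomotopyEquiv M (Metric.sphere (0 : EuclideanSpace ℝ (Fin 5)) 1)) → ∀ (n : ℕ) (P Q : ℕ → Type) [∀ i, TopologicalSpace (P i)] [∀ i, T2Space (P i)] [∀ i, SecondCountableTopology (P i)] [∀ i, ChartedSpace (EuclideanSpace ℝ (Fin 4)) (P i)] [∀ i, IsManifold (𝓡 4) ∞ (P i)] [∀ i, CompactSpace (P i)] [∀ i, TopologicalSpace (Q i)] [∀ i, T2Space (Q i)] [∀ i, SecondCountableTopology (Q i)] [∀ i, ChartedSpace (EuclideanSpace ℝ (Fin 4)) (Q i)] [∀ i, IsManifold (𝓡 4) ∞ (Q i)] [∀ i, CompactSpace (Q i)] (o : ∀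 i, Literature.Topology.FourManifolds.SmoothOrientation (𝓡 4) (P i)) (c : ∀ i, i < n → Literature.Topology.FourManifolds.SmoothOrientation (𝓡 4) Literature.Topology.FourManifolds.ComplexProjectivePlane), Nonempty (P 0 ≃ₘ⟮𝓡 4, 𝓡 4⟯ M) → Nonempty (Q 0 ≃ₘ⟮𝓡 4, 𝓡 4⟯ (Metric.sphere (0 : EuclideanSpace ℝ (Fin 5)) 1)) → (∀ i (hi : i < n), Literature.Topology.FourManifolds.IsOrientedConnectedSum (o i) (c i hi) (o (i + 1))) → (∀ i j (hi : i < n) (hj : j < n), c i hi = c j hj) → (∀ i < n, Literature.Topology.FourManifolds.IsConnectedSum (𝓡 4) (𝓡 4) (𝓡 4) (Q i) Literature.Topology.FourManifolds.ComplexProjectivePlane (Q (i + 1))) → Nonempty (P n ≃ₘ⟮𝓡 4, 𝓡 4⟯ Q n) → 0 < n → ∃ (P' : Type) (_ : TopologicalSpace P') (_ : T2Space P') (_ : SecondCountableTopology P') (_ : ChartedSpace (EuclideanSpace ℝ (Fin 4)) P') (_ : IsManifold (𝓡 4) ∞ P'), Literature.Topology.FourManifolds.IsConnectedSum (𝓡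 4) (𝓡 4) (𝓡 4) M Literature.Topology.FourManifolds.ComplexProjectivePlane P' ∧ Nonempty (P' ≃ₘ⟮𝓡 4, 𝓡 4⟯ Literature.Topology.FourManifolds.ComplexProjectivePlane)

-- parent: DefiniteCancellation · glue (gen 1)
/--     item stmt-SmoothPoincare4-26488 · support · rank 203 · open
    parent: DefiniteCancellation · GLUE: children ⟹ parent · by planner
CP2CancellationOne → DefiniteDescent → DefiniteCancellation (layer-2 split of the recognition
residual R: ℂℙ²-cancellation at rank one — pooled with DissolvableGluck #17708 — plus DEFINITE
DESCENT / rank collapse; proof kernel-checked in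
run/shared/lean/pub/decomp-sp4/decomp-sp4-lens-6/v2/split/RootDecompBSplit.lean
`Split.definiteCancellation_of_one_descent` with exactness
`Split.definiteCancellation_iff_one_descent`, rc0 · 0 sorry · axioms std, Mathlib + the route defs
only — to be landed by a prover in Theorems) -/
@[route_item "route-SmoothPoincare4-RootDecompB"]
def DefiniteCancellationGlue : Prop :=
  CP2CancellationOne → DefiniteDescent → DefiniteCancellation

/-- item stmt-SmoothPoincare4-24779 · crux · rank 3 · open · by planner
why it might fail: a homotopy sphere built to defeat the FGMW s-strategy's converse could resist one-sign blow-ups at every rank; only Gluck twists (n = 1) and Gompf's H_(n,k) family are verified; MMSW Q9.12 is open even for presentation spheres D(P).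
sources: arXiv:1910.08195, doi:10.1016/0040-9383(91)90036-4, arXiv:2210.07510
[crux] every smooth homotopy 4-sphere M admits, for some n ≥ 0, a coherently oriented one-chirality
blow-up chain P 0 ≅ M, P (i+1) = P i # ℂℙ² and a chain Q 0 ≅ S⁴, Q (i+1) = Q i # ℂℙ² with P n ≅ Q n
(M # nℂℙ² ≅ #nℂℙ² or M # nℂℙ²bar ≅ #nℂℙ²bar for some n). Critic verdict: WEAKER (census B3(b) ✓ALL
Φ2 — Gordon 1976 Thm 4.6 / Melvin, tree `dissolvesInCP2_of_isGluckTwist'`; Gompf 1991 p.102;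
dominated by DissolveOne stmt-SmoothPoincare4-17710 and by rigidity of any single #nℂℙ²; printed
OPEN arXiv:1910.08195 Q9.12, arXiv:2210.07510 Q2) · ATTACKABLE (Kirby calculus) · INSTRUMENTABLE
(test M10-ℂℙ², ≈30 core-h) — CLEARED decomp-sp4-crit-1-g0 2026-08-30T01:33:40Z; node score = this
piece. [difficulty: L] -/
@[route_item "route-SmoothPoincare4-RootDecompB", crux]
def DefiniteDissolution : Prop :=
  open scoped ContDiff in ∀ (M : Type) [TopologicalSpace M] [T2Space M] [SecondCountableTopology M] [ChartedSpace (EuclideanSpace ℝ (Fin 4)) M] [IsManifold (𝓡 4) ∞ M], Nonempty (ContinuousMap.HomotopyEquiv M (Metric.sphere (0 : EuclideanSpace ℝ (Fin 5)) 1)) → ∃ (n : ℕ) (P Q : ℕ → Type) (_ : ∀ i, TopologicalSpace (P i)) (_ : ∀ i, T2Space (P i)) (_ : ∀ i, SecondCountableTopology (P i)) (_ : ∀ i, ChartedSpace (EuclideanSpace ℝ (Fin 4)) (P i)) (_ : ∀ i, IsManifold (𝓡 4) ∞ (P i)) (_ : ∀ i, CompactSpace (P i)) (_ : ∀ i, TopologicalSpace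 (Q i)) (_ : ∀ i, T2Space (Q i)) (_ : ∀ i, SecondCountableTopology (Q i)) (_ : ∀ i, ChartedSpace (EuclideanSpace ℝ (Fin 4)) (Q i)) (_ : ∀ i, IsManifold (𝓡 4) ∞ (Q i)) (_ : ∀ i, CompactSpace (Q i)) (o : ∀ i, Literature.Topology.FourManifolds.SmoothOrientation (𝓡 4) (P i)) (c : ∀ i, i < n → Literature.Topology.FourManifolds.SmoothOrientation (𝓡 4) Literature.Topology.FourManifolds.ComplexProjectivePlane), Nonempty (P 0 ≃ₘ⟮𝓡 4, 𝓡 4⟯ M) ∧ Nonempty (Q 0 ≃ₘ⟮𝓡 4, 𝓡 4⟯ (Metric.sphere (0 : EuclideanSpace ℝ (Fin 5)) 1)) ∧ (∀ i (hi : i < n), Literature.Topology.FourManifolds.IsOrientedConnectedSum (o i) (c i hi) (o (i + 1))) ∧ (∀ i j (hi : i < n) (hj : j < n), c i hi = c j hj) ∧ (∀ i < n, Literature.Topology.FourManifolds.IsConnectedSum (𝓡 4) (𝓡 4) (𝓡 4) (Q i) Literature.Topology.FourManifolds.ComplexProjectivePlane (Q (i + 1))) ∧ Nonempty (P n ≃ₘ⟮𝓡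 4, 𝓡 4⟯ Q n)

/-- item stmt-SmoothPoincare4-24780 · assembly · rank 1 · open · by planner
sources: arXiv:1910.08195
[assembly] DefiniteDissolution → DefiniteCancellation → SmoothPoincare4 -/
@[route_item "route-SmoothPoincare4-RootDecompB"]
def Assembly : Prop :=
  DefiniteDissolution → DefiniteCancellation → _root_.SmoothPoincare4

/-! D-0027 §2.1 — DECIDING THEOREM (planner-authored via `route open/edit --closes-file`; by planner-decomp-sp4-writer-1-g0-0 2026-08-30T02:03:13Z):
its hypotheses are this route's items and its conclusion the sub-problem Statement (glue_lint), and it elaborates with this file. -/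

@[closes "route-SmoothPoincare4-RootDecompB"] theorem closes (h₁ : DefiniteDissolution) (h₂ : DefiniteCancellation) :
    _root_.SmoothPoincare4 := by
  intro M _ _ _ _ _ e
  obtain ⟨n, P, Q, iPt, iPh, iPs, iPc, iPm, iPk, iQt, iQh, iQs, iQc, iQm, iQk, o, c,
    hP0, hQ0, hP, hc, hQ, hPQ⟩ := h₁ M ⟨e⟩
  exact h₂ M ⟨e⟩ n P Q o c hP0 hQ0 hP hc hQ hPQ

end Summit.SmoothPoincare4.SmoothPoincare4.Theses.RootDecompB
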